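import Summits.Ventures.HodgeRepro2.T5SU11LegendreGenerating
import Summits.Ventures.HodgeRepro2.T5SU11LegendreHeine
import Summits.Ventures.HodgeRepro2.T5SU11JacobiEvenProduct
import Summits.Ventures.HodgeRepro2.T5SU11LegendreIdentities

/-!
# The Legendre chapter of the explicit model, in one place: the spherical functions of even integer parameter

A summary module (S4.74.2 (xlviii)): the headline statements of rows 363–382 about `φ_{2n+2}` and the Legendre
polynomials `P_n` (DEFINED by Bonnet's recursion in `T5SU11SphericalLegendreAll`), restated under uniform names and
proved by reference, plus two group-side forms not stated before:

* **the generating function on the group**: for every `g` and `0 ≤ r < (|a(g)| + |b(g)|)^{−2}`,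
  **`Σ_n φ_{2n+2}(g) rⁿ = 1/√(1 − 2 φ_4(g) r + r²)`** (`tsum_sph_even_mul_pow`), because
  `ρ(φ_4(g)) = φ_4(g) + √(φ_4(g)² − 1) = (|a| + |b|)²` (`rho_sph_four`);
* **Heine's expansion in the matrix entries**: with `q(g) := (|a(g)| + |b(g)|)² = e^{2 t(g)}`,
  **`φ_{2n+2}(g) = Σ_{k ≤ n} a_k a_{n−k} q(g)^{2k − n}`** (`sph_even_eq_sum_zpow`), `a_k = C(2k,k)/4^k`.

Index (row → declaration here → original):
363 `sph_even_eq_legP_cosh` (φ_{2n+2}(a_t) = P_n(cosh 2t)), `sph_even_eq_legP_sph_four`, `sph_even_bonnet`;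
369 `legP_bounds_on_group` (φ_4ⁿ ≤ φ_{2n+2} ≤ (|a|+|b|)^{2n}); 371/380 `cfun_neg_two_mul_eq` (c(−2n) = C(2n,n)/4ⁿ);
377 `legP_closed_form`, `phase_coefficients`; 378/379 `legendre_generating_formal`, `legendre_generating`;
380 `heine_expansion`, `central_binomial_identity`, `sph_even_next_term`; 381 `jacobi_even_product`,
`partial_fraction_identity`, `mean_phase_even`, `variance_phase_even`; 382 `christoffel_darboux_group`.
Nothing is claimed about (N).

Blind lane: Mathlib + the HodgeRepro2 prefix only; no sorry; axioms ⊆ {propext, Classical.choice,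
Quot.sound}.
-/

namespace Summit.Ventures.HodgeRepro2.T5SU11LegendreSummary

open MeasureTheory Metric Set Filter Topology Finset
open T5SU11Unimodular T5SU11Fibration T5SU11Cartan T5SU11OneParameter T5SU11CartanProjection T5HaarCircle
  T5BergmanCoefficient T5SU11FibrationHaar T5SU11SphericalFunction T5SU11SphericalLegendre
  T5SU11SphericalLegendreAll T5SU11SphericalLegendreLaplace T5SU11SphericalAsymptotic T5SU11SphericalLegendreCfun
  T5SU11JacobiLaplacePhase T5SU11JacobiPhaseLawEven T5SU11LegendreShiftedBridge T5SU11LegendreGeneratingFormal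
  T5SU11LegendreGenerating T5SU11LegendreHeine T5SU11JacobiEvenProduct T5SU11LegendreIdentities
open scoped Real

/-! ### The Cartan coordinate and `(|a| + |b|)²` -/

/-- `t(g) ≥ 0`. -/
theorem cartanT_nonneg (g : SU11) : 0 ≤ cartanT g := by
  unfold cartanT
  exact Real.arsinh_nonneg_iff.mpr (norm_nonneg _)

/-- **`e^{t(g)} = |a(g)| + |b(g)|`.** -/
theorem exp_cartanT (g : SU11) : Real.exp (cartanT g) = ‖mat g 0 0‖ + ‖mat g 0 1‖ := by
  rw [← Real.cosh_add_sinh, cosh_cartanT, sinh_cartanT]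

/-- `(|a| + |b|)² = e^{2 t(g)}`. -/
theorem norm_add_sq_eq_exp (g : SU11) : (‖mat g 0 0‖ + ‖mat g 0 1‖) ^ 2 = Real.exp (2 * cartanT g) := by
  rw [← exp_cartanT, ← Real.exp_nat_mul]
  push_cast
  ring_nf

/-! ### Index of the chapter, polynomial side (proved by reference) -/

/-- 371/380: `c(−2n) = C(2n, n)/4ⁿ`. -/
theorem cfun_neg_two_mul_eq (n : ℕ) : cfun (-(2 * (n : ℝ))) = ((2 * n).choose n : ℝ) / 4 ^ n :=
  (binomHalf_eq_cfun n).symm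

/-- 377: `P_n(x) = Σ_{k ≤ n} C(n,k) C(n+k,n) ((x − 1)/2)^k`. -/
theorem legP_closed_form (n : ℕ) (x : ℝ) :
    legP n x = ∑ k ∈ range (n + 1), (n.choose k : ℝ) * ((n + k).choose n : ℝ) * ((x - 1) / 2) ^ k :=
  legP_eq_sum n x

/-- 377: the coefficients of the phase law at `λ = 2n + 2`. -/
theorem phase_coefficients (n i : ℕ) :
    (legShift n).coeff i = (-1) ^ (n + i) * (n.choose i : ℝ) * ((n + i).choose n : ℝ) :=
  coeff_legShift n i

/-- 378: the generating function, formally. -/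
theorem legendre_generating_formal (x : ℝ) : legSeries x * legSeries x * legQuad x = 1 :=
  legSeries_sq_mul_legQuad x

/-- 379: the generating function, analytically. -/
theorem legendre_generating {x r : ℝ} (hx : 1 ≤ x) (hr0 : 0 ≤ r) (hr : r * rho x < 1) :
    ∑' n : ℕ, legP n x * r ^ n = 1 / Real.sqrt (1 - 2 * x * r + r ^ 2) :=
  tsum_legP_mul_pow hx hr0 hr

/-- 380: Heine's expansion. -/
theorem heine_expansion (n : ℕ) (t : ℝ) :
    legP n (Real.cosh (2 * t))
      = ∑ k ∈ range (n + 1), binomHalf k * binomHalf (n - k) * Real.exp ((4 * (k : ℝ) - 2 * n) * t) :=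
  legP_cosh_eq_sum_exp n t

/-- 380: `Σ_{k ≤ n} C(2k,k) C(2n−2k,n−k) = 4ⁿ`. -/
theorem central_binomial_identity (n : ℕ) :
    ∑ k ∈ range (n + 1), (2 * k).choose k * (2 * (n - k)).choose (n - k) = 4 ^ n :=
  sum_centralBinom_mul_centralBinom n

/-- 381: the partial-fraction identity, proved by the group. -/
theorem partial_fraction_identity (n : ℕ) {k : ℝ} (hk : 2 * (n : ℝ) + 2 < k) :
    ∑ i ∈ range (n + 1), (-1) ^ (n + i) * (n.choose i : ℝ) * ((n + i).choose n : ℝ) / (k - 2 - 2 * (i : ℝ))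
      = (∏ i ∈ range n, (k + 2 * i) / (k - 4 - 2 * i)) / (k - 2) :=
  sum_partial_fraction_eq_prod n hk

section measure

variable [MeasurableSpace Circle] [BorelSpace Circle]

/-- **`cosh(2 t(g)) = φ_4(g)`.** -/
theorem cosh_two_mul_cartanT (g : SU11) : Real.cosh (2 * cartanT g) = sph 4 g := by
  rw [Real.cosh_two_mul, sph_four, ← cosh_cartanT]
  have := Real.cosh_sq (cartanT g)
  linarith

/-- **`ρ(φ_4(g)) = (|a(g)| + |b(g)|)²`**, the growth rate of `n ↦ φ_{2n+2}(g)`. -/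
theorem rho_sph_four (g : SU11) : rho (sph 4 g) = (‖mat g 0 0‖ + ‖mat g 0 1‖) ^ 2 := by
  rw [rho, sqrt_sph_four_sq_sub_one, sph_four_eq_add]
  ring

/-! ### The generating function and Heine's expansion on the group -/

/-- **`Σ_n φ_{2n+2}(g) rⁿ = 1/√(1 − 2 φ_4(g) r + r²)`** for `0 ≤ r`, `r (|a(g)| + |b(g)|)² < 1`. -/
theorem tsum_sph_even_mul_pow (g : SU11) {r : ℝ} (hr0 : 0 ≤ r) (hr : r * (‖mat g 0 0‖ + ‖mat g 0 1‖) ^ 2 < 1) :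
    ∑' n : ℕ, sph (2 * (n : ℝ) + 2) g * r ^ n = 1 / Real.sqrt (1 - 2 * sph 4 g * r + r ^ 2) := by
  simp only [sph_even_eq_sph_four]
  exact tsum_legP_mul_pow (one_le_sph_four g) hr0 (by rwa [rho_sph_four])

/-- The series converges. -/
theorem summable_sph_even_mul_pow (g : SU11) {r : ℝ} (hr0 : 0 ≤ r)
    (hr : r * (‖mat g 0 0‖ + ‖mat g 0 1‖) ^ 2 < 1) :
    Summable fun n : ℕ => sph (2 * (n : ℝ) + 2) g * r ^ n := by
  simp only [sph_even_eq_sph_four]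
  exact summable_legP_mul_pow (one_le_sph_four g) hr0 (by rwa [rho_sph_four])

/-- **Heine's expansion in the matrix entries**: `φ_{2n+2}(g) = Σ_{k ≤ n} a_k a_{n−k} ((|a| + |b|)²)^{2k − n}`. -/
theorem sph_even_eq_sum_zpow (n : ℕ) (g : SU11) :
    sph (2 * (n : ℝ) + 2) g
      = ∑ k ∈ range (n + 1), binomHalf k * binomHalf (n - k)
          * ((‖mat g 0 0‖ + ‖mat g 0 1‖) ^ 2) ^ (2 * (k : ℤ) - n) := by
  rw [sph_eq_sph_hyp_cartanT, sph_even_hyp_eq_sum, norm_add_sq_eq_exp]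
  refine Finset.sum_congr rfl fun k _ => ?_
  congr 1
  rw [← Real.rpow_intCast, ← Real.exp_mul]
  congr 1
  push_cast
  ring

/-! ### Index of the chapter, group side (proved by reference) -/

/-- 363: `φ_{2n+2}(a_t) = P_n(cosh 2t)`. -/
theorem sph_even_eq_legP_cosh (n : ℕ) (t : ℝ) : sph (2 * (n : ℝ) + 2) (hyp t) = legP n (Real.cosh (2 * t)) :=
  sph_even_hyp n t

/-- 363: `φ_{2n+2} = P_n(φ_4)` on the group. -/
theorem sph_even_eq_legP_sph_four (n : ℕ) (g : SU11) : sph (2 * (n : ℝ) + 2) g = legP n (sph 4 g) :=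
  sph_even_eq_sph_four n g

/-- 363: Bonnet's recursion on the group. -/
theorem sph_even_bonnet (n : ℕ) (g : SU11) :
    ((n : ℝ) + 2) * sph (2 * ((n : ℝ) + 2) + 2) g
      = (2 * (n : ℝ) + 3) * sph 4 g * sph (2 * ((n : ℝ) + 1) + 2) g - ((n : ℝ) + 1) * sph (2 * (n : ℝ) + 2) g :=
  sph_even_recursion n g

/-- 369: `φ_4(g)ⁿ ≤ φ_{2n+2}(g) ≤ (|a(g)| + |b(g)|)^{2n}`. -/
theorem legP_bounds_on_group (n : ℕ) (g : SU11) :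
    sph 4 g ^ n ≤ sph (2 * (n : ℝ) + 2) g ∧ sph (2 * (n : ℝ) + 2) g ≤ (‖mat g 0 0‖ + ‖mat g 0 1‖) ^ (2 * n) :=
  ⟨sph_four_pow_le_sph_even n g, sph_even_le_norm_add_pow n g⟩

/-- 380: the next term of `e^{−2nt} φ_{2n+2}(a_t)`. -/
theorem sph_even_next_term {n : ℕ} (hn : 1 ≤ n) :
    Tendsto (fun t => Real.exp (4 * t) * (Real.exp (-(2 * (n : ℝ)) * t) * sph (2 * (n : ℝ) + 2) (hyp t)
      - cfun (-(2 * (n : ℝ))))) atTop (𝓝 (binomHalf (n - 1) / 2)) := by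
  simp only [sph_even_hyp]
  exact tendsto_exp_mul_sub_cfun hn

/-- 381: the product form of the transform at `λ = 2n + 2`. -/
theorem jacobi_even_product (n : ℕ) {k : ℝ} (hk : 2 * (n : ℝ) + 2 < k) :
    ∫ g, (1 - ‖orbit g‖ ^ 2) ^ (k / 2) * sph (2 * (n : ℝ) + 2) g ∂(nu haarCircle)
      = 2 * π / (k - 2) * ∏ i ∈ range n, (k + 2 * i) / (k - 4 - 2 * i) :=
  jacobi_even_eq_prod n hk

/-- 381: the mean phase at `λ = 2n + 2`. -/
theorem mean_phase_even (n : ℕ) {k : ℝ} (hk : 2 * (n : ℝ) + 2 < k) :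
    (∫ g, Real.log ‖mat g 0 0‖ * ((1 - ‖orbit g‖ ^ 2) ^ (k / 2) * sph (2 * (n : ℝ) + 2) g) ∂(nu haarCircle))
        / (∫ g, (1 - ‖orbit g‖ ^ 2) ^ (k / 2) * sph (2 * (n : ℝ) + 2) g ∂(nu haarCircle))
      = (k - 2)⁻¹ + ∑ i ∈ range n, ((k - 4 - 2 * i)⁻¹ - (k + 2 * i)⁻¹) :=
  mean_phase_even_eq n hk

/-- 381: the variance of the phase at `λ = 2n + 2`. -/
theorem variance_phase_even (n : ℕ) {k : ℝ} (hk : 2 * (n : ℝ) + 2 < k) :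
    (∫ g, Real.log ‖mat g 0 0‖ ^ 2 * ((1 - ‖orbit g‖ ^ 2) ^ (k / 2) * sph (2 * (n : ℝ) + 2) g) ∂(nu haarCircle))
        / (∫ g, (1 - ‖orbit g‖ ^ 2) ^ (k / 2) * sph (2 * (n : ℝ) + 2) g ∂(nu haarCircle))
      - ((∫ g, Real.log ‖mat g 0 0‖ * ((1 - ‖orbit g‖ ^ 2) ^ (k / 2) * sph (2 * (n : ℝ) + 2) g) ∂(nu haarCircle))
        / (∫ g, (1 - ‖orbit g‖ ^ 2) ^ (k / 2) * sph (2 * (n : ℝ) + 2) g ∂(nu haarCircle))) ^ 2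
      = ((k - 2) ^ 2)⁻¹ + ∑ i ∈ range n, (((k - 4 - 2 * i) ^ 2)⁻¹ - ((k + 2 * i) ^ 2)⁻¹) :=
  variance_phase_even_eq n hk

/-- 382: the Christoffel–Darboux formula on the group. -/
theorem christoffel_darboux_group (n : ℕ) (g h : SU11) :
    (sph 4 g - sph 4 h) * ∑ k ∈ range (n + 1), (2 * (k : ℝ) + 1) * sph (2 * (k : ℝ) + 2) g * sph (2 * (k : ℝ) + 2) h
      = ((n : ℝ) + 1) * (sph (2 * ((n : ℝ) + 1) + 2) g * sph (2 * (n : ℝ) + 2) h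
          - sph (2 * (n : ℝ) + 2) g * sph (2 * ((n : ℝ) + 1) + 2) h) :=
  sph_christoffel_darboux n g h

end measure

end Summit.Ventures.HodgeRepro2.T5SU11LegendreSummary
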